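import Summits.BirchSwinnertonDyer.Rank1Residual.Additive.LegendreTwistRelationOfCharTwist
import HarnessLib

/-!
# Route `InertBadSignedBranches` (rung K8), crux `CccOneLawOnTypeIstarZero` (stmt-…-19223), stub U:
# Stevens' Lemma 5.4 at level `Γ₀` — the period lattice of a `(·/p)`-twisted newform,
# `τ · Λ_{f ⊗ (·/p)} ⊆ Λ_f` (helper toward stmt-BirchSwinnertonDyer-19223; cell bsd-cm, seat
# bsd-cm-k8i-c2 g6; first of three files `…TwistPeriodLattice` → `…ManinTwist` → `…ManinTwistOnType`)

PURPOSE. The registered stub U (`stub_etaValuationUpper`) of the crux's A12 skeleton is the Kolyvagin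
upper half on the signed type `(p, I₀*)`; its only non-published input at `p ∈ {5, 7}` was the Manin
datum `p ∤ c` (Edixhoven 1991 Thm. 3 needs `p > 7`). The sibling file `…ManinTwist` proves that datum
for the `p*`-twist class of any curve good at `p` by G. Stevens' lattice argument (Invent. Math. 98
(1989) §5, Thm. 5.1 / Lemma 5.2 / (5.5) / Lemma 5.4, pp. 96–99 — read first-hand from the GDZ scan;
Stevens works with `X₁(N)`-lattices modulo his Conjecture I″, we work `p`-locally with
`X₀(N)`-lattices, where no conjecture is needed). THIS file is the analytic input of that argument:

**`mul_mem_periodLattice_of_cuspCoeff_eq_legendreSym_mul`** — for an odd prime `p`, cusp forms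
`f ∈ S₂(Γ₀(N))`, `g ∈ S₂(Γ₀(N'))` with `aₙ(f) = (n/p)·aₙ(g)` for all `n`, `N' ∣ N`, `p² ∣ N`, and
`τ = τ((·/p))` the quadratic Gauss sum: `τ · Λ_f ⊆ Λ_g`. Proof: on the generators `{∞, γ∞}_f`
(`γ ∈ Γ₀(N)`) the twisting identity `{∞, r}_f = τ⁻¹ ∑_{u mod p} (u/p) {∞, r + u/p}_g` (tree:
`Additive.modularSymbol_eq_sum_of_cuspCoeff_eq` — Shimura 1971 Prop. 3.64 integrated along the
vertical ray; Stevens (5.5)) and the cusp bookkeeping of Stevens' Lemma 5.4: with `c = c(γ)`,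
`p² ∣ c` and `N' ∣ c`, the cusp `γ∞ + u/p = (a + u·c/p)/c` is in lowest terms with denominator `c`,
hence `Γ₀(N')`-equivalent to `∞`, so its symbol is a period of `g`
(`modularSymbol_mem_periodLattice_of_dvd_den`, `modularSymbol_div_add_div_mem_periodLattice`).

HONEST LABEL: proved theorems only (no `def`, no named fact, no `sorry`); nothing about any curve is
claimed here; the crux 19223, STEP L and O10 stay OPEN; nothing booked.

References: G. Stevens, Invent. Math. 98 (1989) 75–106, §5 Lemma 5.4 and (5.5); G. Shimura,
*Introduction to the arithmetic theory of automorphic functions* (1971) Prop. 3.64; Ju. I. Manin,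
Izv. 36 (1972) Prop. 1.4, Thm. 1.6; B. Mazur, J. Tate, J. Teitelbaum, Invent. Math. 84 (1986) §I.8.
-/

set_option autoImplicit false
set_option linter.dupNamespace false

noncomputable section

open scoped Classical MatrixGroups ModularForm

open CongruenceSubgroup
open Literature.NumberTheory.EllipticCurves
open Literature.NumberTheory.EllipticCurves.ModularForms
open Summit.BirchSwinnertonDyer.Rank1Residual

namespace Summit.BirchSwinnertonDyer.BirchSwinnertonDyer.Theorems.CccOneManinTwist

/-! ## Stevens' Lemma 5.4 at level `Γ₀`: `τ · Λ_{f ⊗ (·/p)} ⊆ Λ_f` -/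

section Lattice

variable {N' : ℕ} (g : CuspForm (Gamma0 N') 2)

/-- **Cusps with denominator divisible by the level are `Γ₀(N')`-equivalent to `∞`**: for coprime
integers `a, c` with `c ≠ 0` and `N' ∣ c`, the modular symbol `{∞, a/c}_g` is the period
`{∞, δ∞}_g` of `δ = (a *; c *) ∈ Γ₀(N')` (Bezout), hence lies in the period lattice `Λ_g`.
[cite: Manin1972, Prop. 1.4 and Thm. 1.6] -/
theorem modularSymbol_mem_periodLattice_of_dvd_den {a c : ℤ} (hac : IsCoprime a c) (hc0 : c ≠ 0)
    (hN' : (N' : ℤ) ∣ c) : modularSymbol g ((a : ℚ) / c) ∈ periodLattice g := by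
  obtain ⟨x, y, hxy⟩ := hac
  let δ : SL(2, ℤ) := ⟨!![a, -y; c, x], by rw [Matrix.det_fin_two_of]; linear_combination hxy⟩
  have hδ : δ ∈ Gamma0 N' := by
    rw [Gamma0_mem]
    show ((c : ℤ) : ZMod N') = 0
    exact (ZMod.intCast_zmod_eq_zero_iff_dvd c N').mpr hN'
  have key : (if c = 0 then (0 : ℂ) else modularSymbol g ((a : ℚ) / c)) ∈ periodLattice g :=
    cuspSymbol_mem_periodLattice g ⟨δ, hδ⟩
  rwa [if_neg hc0] at key

/-- **The cusp bookkeeping of Stevens' Lemma 5.4 at level `Γ₀`.** For `γ = (a b; c d) ∈ SL₂(ℤ)`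
with `c ≠ 0`, `p² ∣ c` and `N' ∣ c`, and any `k : ℕ`: the cusp `a/c + k/p = (a + k·c/p)/c` is in
lowest terms with denominator `c` (every prime of `c` divides `c/p`, and `gcd(a, c) = 1`), so
`{∞, a/c + k/p}_g ∈ Λ_g`. [cite: Manin1972, Prop. 1.4 and Thm. 1.6] -/
theorem modularSymbol_div_add_div_mem_periodLattice {p : ℕ} {a c : ℤ} (hac : IsCoprime a c)
    (hc0 : c ≠ 0) (hN' : (N' : ℤ) ∣ c) (hpc : (p : ℤ) ^ 2 ∣ c) (k : ℕ) :
    modularSymbol g ((a : ℚ) / c + (k : ℚ) / p) ∈ periodLattice g := by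
  obtain ⟨m, hm⟩ := hpc
  have hp0 : (p : ℤ) ≠ 0 := by
    rintro h
    rw [h, zero_pow two_ne_zero, zero_mul] at hm
    exact hc0 hm
  have hm0 : m ≠ 0 := by rintro rfl; rw [mul_zero] at hm; exact hc0 hm
  -- `gcd(a, p) = gcd(a, m) = 1`
  have hap : IsCoprime a (p : ℤ) :=
    hac.of_isCoprime_of_dvd_right ⟨p * m, by rw [hm]; ring⟩
  have ham : IsCoprime a m := hac.of_isCoprime_of_dvd_right ⟨(p : ℤ) ^ 2, by rw [hm]; ring⟩
  -- `a' = a + k p m` is prime to `c = p² m`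
  have ha'p : IsCoprime (a + (p : ℤ) * (k * m)) (p : ℤ) := hap.add_mul_left_left _
  have ha'm : IsCoprime (a + m * (k * p)) m := ham.add_mul_left_left _
  have heq : a + m * (k * (p : ℤ)) = a + (p : ℤ) * (k * m) := by ring
  rw [heq] at ha'm
  have ha'c : IsCoprime (a + (p : ℤ) * (k * m)) c := by
    rw [hm]
    exact (ha'p.pow_right (n := 2)).mul_right ha'm
  have key := modularSymbol_mem_periodLattice_of_dvd_den g ha'c hc0 hN'
  have hcQ : (c : ℚ) ≠ 0 := by exact_mod_cast hc0
  have hpQ : (p : ℚ) ≠ 0 := by exact_mod_cast hp0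
  have hmQ : (m : ℚ) ≠ 0 := by exact_mod_cast hm0
  have hrat : (((a + (p : ℤ) * (k * m) : ℤ)) : ℚ) / c = (a : ℚ) / c + (k : ℚ) / p := by
    have hcq : (c : ℚ) = (p : ℚ) ^ 2 * m := by exact_mod_cast hm
    rw [hcq]
    push_cast
    field_simp
  rwa [hrat] at key

/-- **Stevens 1989, Lemma 5.4, at level `Γ₀` and `p`-locally usable form: `τ · Λ_f ⊆ Λ_g` for a
`q`-expansion twist `aₙ(f) = (n/p)·aₙ(g)`.** Let `p` be an odd prime, `f ∈ S₂(Γ₀(N))`,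
`g ∈ S₂(Γ₀(N'))` with `aₙ(f) = (n/p) aₙ(g)` for all `n`, `N' ∣ N` and `p² ∣ N`, and
`τ = τ((·/p))` the Gauss sum of `(·/p) ⊗ ℂ` against `e^{2πi·/p}`. Then `τ·z ∈ Λ_g` for every
`z ∈ Λ_f`: on the generators `{∞, γ∞}_f`, `γ ∈ Γ₀(N)`, the twisting identity
`{∞, r}_f = τ⁻¹ ∑_{u mod p} (u/p) {∞, r + u/p}_g` (`Additive.modularSymbol_eq_sum_of_cuspCoeff_eq`,
Shimura 1971 Prop. 3.64 integrated along the vertical ray — Stevens' (5.5)) and the cusp bookkeeping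
`modularSymbol_div_add_div_mem_periodLattice`. (Stevens states the `Γ₁(N)`-version
`ℒ(f_ψ) ⊆ τ(ψ)⁻¹ ℒ(f)`; the proof is the same.) [cite: Shimura1971, Prop. 3.64]
[cite: Manin1972, Prop. 1.4 and Thm. 1.6] -/
theorem mul_mem_periodLattice_of_cuspCoeff_eq_legendreSym_mul {p : ℕ} [hp : Fact p.Prime]
    (hp2 : p ≠ 2) {N : ℕ} [NeZero N] [NeZero N'] {f : CuspForm (Gamma0 N) 2}
    (h : ∀ n, cuspCoeff f n = (legendreSym p n : ℂ) * cuspCoeff g n) (hN : N' ∣ N)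
    (hpN : p ^ 2 ∣ N) :
    ∀ z ∈ periodLattice f,
      gaussSum ((quadraticChar (ZMod p)).ringHomComp (Int.castRingHom ℂ))
          (ZMod.stdAddChar (N := p)) * z ∈ periodLattice g := by
  set τ : ℂ := gaussSum ((quadraticChar (ZMod p)).ringHomComp (Int.castRingHom ℂ))
    (ZMod.stdAddChar (N := p)) with hτ
  -- `τ ≠ 0` (`τ² = ±p`)
  have hF : ringChar (ZMod p) ≠ 2 := by rwa [ZMod.ringChar_zmod_n]
  have hne : (quadraticChar (ZMod p)).ringHomComp (Int.castRingHom ℂ) ≠ 1 :=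
    (MulChar.ringHomComp_ne_one_iff (RingHom.injective_int _)).mpr (quadraticChar_ne_one hF)
  have hτsq : τ ^ 2 = ((quadraticChar (ZMod p)).ringHomComp (Int.castRingHom ℂ)) (-1) * p := by
    rw [hτ, gaussSum_sq hne ((quadraticChar_isQuadratic (ZMod p)).comp _)
      (ZMod.isPrimitive_stdAddChar p), ZMod.card]
  have hτ0 : τ ≠ 0 := by
    intro h0
    have h1 : ((quadraticChar (ZMod p)).ringHomComp (Int.castRingHom ℂ)) (-1) * (p : ℂ) = 0 := by
      rw [← hτsq, h0, zero_pow two_ne_zero]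
    rcases mul_eq_zero.mp h1 with h2 | h2
    · rw [MulChar.ringHomComp_apply, quadraticChar_neg_one hF, ZMod.card, eq_intCast,
        Int.cast_eq_zero] at h2
      have h3 := ZMod.χ₄_eq_neg_one_pow (Nat.odd_iff.mp (hp.out.odd_of_ne_two hp2))
      rw [h2] at h3
      exact (pow_ne_zero _ (by norm_num : (-1 : ℤ) ≠ 0)) h3.symm
    · exact hp.out.ne_zero (by exact_mod_cast h2)
  -- the target subgroup `{z | τ z ∈ Λ_g}`
  let S : AddSubgroup ℂ := (periodLattice g).comap (AddMonoidHom.mulLeft τ)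
  suffices hle : periodLattice f ≤ S by
    intro z hz
    exact hle hz
  rw [periodLattice, AddSubgroup.closure_le]
  rintro _ ⟨γ, rfl⟩
  show τ * cuspSymbol f γ ∈ periodLattice g
  unfold cuspSymbol
  split_ifs with hc
  · rw [mul_zero]; exact zero_mem _
  · rw [Additive.modularSymbol_eq_sum_of_cuspCoeff_eq hp2 h, ← hτ, ← mul_assoc,
      mul_inv_cancel₀ hτ0, one_mul]
    refine AddSubgroup.sum_mem _ fun u _ ↦ ?_
    rw [← zsmul_eq_mul]
    refine AddSubgroup.zsmul_mem _ ?_ _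
    -- the cusp `γ∞ + u/p` has denominator `c(γ)`, divisible by `N'`
    have hdet := (γ : SL(2, ℤ)).2
    rw [Matrix.det_fin_two] at hdet
    have hac : IsCoprime ((γ : SL(2, ℤ)) 0 0) ((γ : SL(2, ℤ)) 1 0) :=
      ⟨(γ : SL(2, ℤ)) 1 1, -(γ : SL(2, ℤ)) 0 1, by linear_combination hdet⟩
    have hcN : (N : ℤ) ∣ (γ : SL(2, ℤ)) 1 0 :=
      (ZMod.intCast_zmod_eq_zero_iff_dvd _ N).mp (Gamma0_mem.mp γ.2)
    exact modularSymbol_div_add_div_mem_periodLattice g hac hc ((Int.natCast_dvd_natCast.mpr hN).trans hcN)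
      ((by exact_mod_cast hpN : (p : ℤ) ^ 2 ∣ (N : ℤ)).trans hcN) u.val

end Lattice

end Summit.BirchSwinnertonDyer.BirchSwinnertonDyer.Theorems.CccOneManinTwist

end
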